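import Literature.NumberTheory.Automorphic.RestrictedProductBoxHeckeScalar
import Literature.NumberTheory.Automorphic.HeckeFixedVectorsLift
import Literature.NumberTheory.Automorphic.FlathLocalLemmas
import HarnessLib

/-!
# The `K^S`-fixed vectors of irreducible representations of a restricted product: irreducibility under the `S`-places and
# the lift of an `S`-equivariant map to an isomorphism (uniqueness half of Flath's theorem, no Gelfand pairs)

Topic `NumberTheory/Automorphic`; namespace `Literature.NumberTheory.Automorphic`.  THEOREMS ONLY, over ★
`RestrictedProductBoxHeckeScalar` (Hecke operators of the box `C = K^S` act by `(∏ c_i(γ_i)) • π(g₀)`), ★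
`HeckeFixedVectorsLift` (`mem_of_mem_span_translates_of_mem_fixedPoints`, `exists_equiv_of_heckeEquivariant`) and ★
`FlathLocalLemmas.span_iUnion_image_eq_top`.

SETTING. `Γ = Πʳ i, [G i, K i]` (any groups, any subgroups, no topology), a finite set `S` of places, the box `C = ∏ L_i` with
`L_i = ⊥` on `S` and `L_i = K_i` off `S` (`K^S`), the local Hecke pairs `(G i, K i)` off `S` having finite double cosets, and a
representation `π` (irreducible, over a field of characteristic `0`) whose local Hecke operators `[K_i a K_i]` off `S` act on
the `K_i`-fixed vectors of `π ∘ ι_i` by scalars `c i a`.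
* `apply_mem_of_forall_mulSingle` — a subspace stable under `π(ι_i a)` (`i ∈ S`) is stable under every `π(g₀)` with `g₀`
  supported on `S`.
* `boxFixed_le_of_stable` (R1) — **`π^C` is irreducible for the `S`-places**: a non-zero subspace `Z ≤ π^C` stable under the
  `π(ι_i a)`, `i ∈ S`, is all of `π^C`.
* `exists_equiv_of_boxFixed_equivariant` (R4) — **two such irreducibles `σ`, `ω` with the SAME local scalars off `S` and a
  non-zero `k`-linear `ψ : σ^C → ω^C` commuting with the `S`-places are ISOMORPHIC, by an isomorphism extending `ψ`**.
This is the rigidity behind the uniqueness half of Flath's theorem ([Flath1979, Thm. 3]; Bump 1997, Thm. 3.4.4 ∕ Prop. 4.2.3;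
Bushnell–Henniart §4.3) stated WITHOUT restricted tensor products and WITHOUT the Gelfand-pair hypothesis: only «the local
Hecke operators act by scalars» at the places off `S` is used.

## References
* D. Flath, *Decomposition of representations into tensor products*, PSPM 33.1 (1979), Thm. 3, §2 Example 2.
* D. Bump, *Automorphic Forms and Representations* (1997), Thm. 3.4.4, Prop. 4.2.3.
-/

set_option autoImplicit false

noncomputable section

open MulAction Filter
open scoped RestrictedProduct

namespace Literature.NumberTheory.Automorphic

universe u v uk w w'

variable {ι : Type u} {G : ι → Type v} [∀ i, Group (G i)] {K : ∀ i, Subgroup (G i)} [DecidableEq ι]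
variable {k : Type uk} [Field k] {V : Type w} [AddCommGroup V] [Module k V]

/-- **Support on `S`.**  If a subspace `Z` is stable under `π(ι_i a)` for all `i ∈ S`, it is stable under `π(g₀)` for every
`g₀` with trivial coordinates off the finite set `S` (`g₀` is the finite product of its coordinates). [cite: FlathCorvallis1979, §2 Example 2] -/
theorem apply_mem_of_forall_mulSingle (π : Representation k (Πʳ i, [G i, K i]) V) (S : Finset ι) :
    ∀ (g₀ : Πʳ i, [G i, K i]), (∀ i, i ∉ S → g₀ i = 1) →
      ∀ (Z : Submodule k V), (∀ i ∈ S, ∀ (a : G i), ∀ z ∈ Z, π (RestrictedProduct.mulSingle K i a) z ∈ Z) →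
        ∀ z ∈ Z, π g₀ z ∈ Z := by
  classical
  induction S using Finset.induction_on with
  | empty =>
    intro g₀ hg₀ Z _ z hz
    have : g₀ = 1 := DFunLike.ext _ _ fun i => by rw [hg₀ i (Finset.notMem_empty i), RestrictedProduct.one_apply]
    rw [this, map_one, Module.End.one_apply]
    exact hz
  | insert j S' hj IH =>
    intro g₀ hg₀ Z hZ z hz
    have h1 : ∀ i, i ∉ S' → ((RestrictedProduct.mulSingle K j (g₀ j))⁻¹ * g₀) i = 1 := fun i hi => by
      by_cases hij : i = j
      · subst hij; simp [RestrictedProduct.mul_apply, RestrictedProduct.inv_apply]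
      · have : g₀ i = 1 := hg₀ i (by simp [hij, hi])
        simp [RestrictedProduct.mul_apply, RestrictedProduct.inv_apply, Pi.mulSingle_eq_of_ne hij, this]
    have h2 := IH _ h1 Z (fun i hi => hZ i (Finset.mem_insert_of_mem hi)) z hz
    have h3 := hZ j (Finset.mem_insert_self j S') (g₀ j) _ h2
    rwa [← Module.End.mul_apply, ← map_mul, mul_inv_cancel_left] at h3

variable (L : ∀ i, Subgroup (G i)) (S : Finset ι) (c : ∀ i, G i → k)

/-- The `S`-part of `γ` (coordinates `γ_i` on `S`, `1` off `S`) as an element of the restricted product. [folklore] -/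
private theorem exists_sPart (γ : Πʳ i, [G i, K i]) :
    ∃ g₀ : Πʳ i, [G i, K i], (∀ i ∈ S, g₀ i = γ i) ∧ ∀ i, i ∉ S → g₀ i = 1 := by
  classical
  refine ⟨⟨fun i => if i ∈ S then γ i else 1, ?_⟩, fun i hi => ?_, fun i hi => ?_⟩
  rotate_left
  · change (if i ∈ S then γ i else 1) = γ i
    simp [hi]
  · change (if i ∈ S then γ i else 1) = 1
    simp [hi]
  filter_upwards [γ.2, (S.finite_toSet).compl_mem_cofinite] with i hi hi'
  simp only [Set.mem_compl_iff, Finset.mem_coe] at hi'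
  simp [hi']

/-- The finite set of bad places of `γ` off `S` (where `γ_i ∉ L_i = K_i`). [folklore] -/
private theorem exists_badSet (hLK : ∀ i, i ∉ S → L i = K i) (γ : Πʳ i, [G i, K i]) :
    ∃ T : Finset ι, (∀ i ∈ T, i ∉ S) ∧ ∀ i, i ∉ T → i ∉ S → γ i ∈ L i := by
  classical
  have hfin : {i | γ i ∉ K i}.Finite := by
    have h := γ.2
    rwa [Filter.eventually_cofinite] at h
  refine ⟨hfin.toFinset.filter fun i => i ∉ S, fun i hi => (Finset.mem_filter.1 hi).2, fun i hiT hiS => ?_⟩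
  rw [hLK i hiS]
  by_contra h
  exact hiT (Finset.mem_filter.2 ⟨hfin.mem_toFinset.2 h, hiS⟩)

/-- **Hecke-pair condition for `K^S`**: every `C γ C / C` is finite, `C = ∏ L_i` with `L_i = ⊥` on `S`, `= K_i` off `S`.
[cite: FlathCorvallis1979, §2 Example 2] -/
theorem finite_orbit_boxSubgroup_of_eq (hLS : ∀ i ∈ S, L i = ⊥) (hLK : ∀ i, i ∉ S → L i = K i)
    (hfin : ∀ i, i ∉ S → ∀ a : G i, (orbit (L i) (a : G i ⧸ L i)).Finite) (γ : Πʳ i, [G i, K i]) :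
    (orbit (boxSubgroup (K := K) L) (γ : (Πʳ i, [G i, K i]) ⧸ boxSubgroup (K := K) L)).Finite := by
  obtain ⟨g₀, hg₀S, hg₀⟩ := exists_sPart S γ
  obtain ⟨T, hTS, hγT⟩ := exists_badSet L S hLK γ
  exact finite_orbit_boxSubgroup L (↑S : Set ι) (fun j hj => hLS j hj) (fun i hi a => hfin i hi a) γ g₀
    (fun j hj => hg₀S j hj) (fun j hj => hg₀ j hj) T (fun i hi => hTS i hi) (fun i hi hi' => hγT i hi hi')

/-- **`[CγC]` on `π^C`: scalar times the `S`-part**, packaged: for every `γ` there are `g₀` supported on `S` (with `g₀_i = γ_i`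
on `S`) and a scalar `d` — depending only on `γ`, `S`, `L` and the local scalars `c` — with `[CγC] w = d • π(g₀) w` for EVERY
representation `π` whose local Hecke operators off `S` act by the `c i a`, and every `w ∈ π^C`. [cite: FlathCorvallis1979, Thm. 2] -/
theorem exists_heckeOperator_boxSubgroup_eq_smul (hLS : ∀ i ∈ S, L i = ⊥) (hLK : ∀ i, i ∉ S → L i = K i)
    (hfin : ∀ i, i ∉ S → ∀ a : G i, (orbit (L i) (a : G i ⧸ L i)).Finite) (γ : Πʳ i, [G i, K i]) :
    ∃ (g₀ : Πʳ i, [G i, K i]) (d : k), (∀ i ∈ S, g₀ i = γ i) ∧ (∀ i, i ∉ S → g₀ i = 1) ∧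
      ∀ (W : Type w') [AddCommGroup W] [Module k W] (π : Representation k (Πʳ i, [G i, K i]) W),
        (∀ i, i ∉ S → ∀ a : G i, ∀ w ∈ Representation.fixedPoints (π.comp (mulSingleHom K i)) (L i),
          heckeOperator (π.comp (mulSingleHom K i)) (L i) a w = c i a • w) →
        ∀ w ∈ π.fixedPoints (boxSubgroup (K := K) L), heckeOperator π (boxSubgroup (K := K) L) γ w = d • π g₀ w := by
  obtain ⟨g₀, hg₀S, hg₀⟩ := exists_sPart S γ
  obtain ⟨T, hTS, hγT⟩ := exists_badSet L S hLK γ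
  refine ⟨g₀, ∏ i ∈ T, c i (γ i), hg₀S, hg₀, fun W _ _ π hc w hw => ?_⟩
  exact heckeOperator_boxSubgroup_apply_eq_smul L (↑S : Set ι) c (fun j hj => hLS j hj) π (fun i hi => hc i hi)
    (fun i hi a => hfin i hi a) γ g₀ (fun j hj => hg₀S j hj) (fun j hj => hg₀ j hj) T (fun i hi => hTS i hi)
    (fun i hi hi' => hγT i hi hi') hw

/-- An element supported on `S` centralises the box `C` (whose `S`-sides are trivial), hence preserves `π^C` (Flath 1979, §2
Example 2: `G_S` commutes with `K^S`). [cite: FlathCorvallis1979, §2 Example 2] -/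
theorem apply_mem_fixedPoints_boxSubgroup_of_support (hLS : ∀ i ∈ S, L i = ⊥) (π : Representation k (Πʳ i, [G i, K i]) V)
    {g₀ : Πʳ i, [G i, K i]} (hg₀ : ∀ i, i ∉ S → g₀ i = 1) {w : V} (hw : w ∈ π.fixedPoints (boxSubgroup (K := K) L)) :
    π g₀ w ∈ π.fixedPoints (boxSubgroup (K := K) L) := by
  rw [Representation.mem_fixedPoints] at hw ⊢
  intro d hd
  have hcomm : d * g₀ = g₀ * d := DFunLike.ext _ _ fun i => by
    rw [RestrictedProduct.mul_apply, RestrictedProduct.mul_apply]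
    by_cases hi : i ∈ S
    · have : d i = 1 := by simpa [hLS i hi] using hd i
      rw [this, one_mul, mul_one]
    · rw [hg₀ i hi, one_mul, mul_one]
  rw [← Module.End.mul_apply, ← map_mul, hcomm, map_mul, Module.End.mul_apply, hw d hd]

variable [CharZero k]

/-- **(R1) The `C`-fixed vectors are irreducible for the `S`-places.**  `π` irreducible, local Hecke operators off `S` acting by
scalars: a non-zero subspace `Z ≤ π^C` stable under all `π(ι_i a)`, `i ∈ S`, is all of `π^C`. (The averaging argument of Bump 1997,
Prop. 4.2.3, for `K^S`: `[CγC] z = d • π(g₀) z ∈ Z`, and ★ `mem_of_mem_span_translates_of_mem_fixedPoints`.)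
[cite: Bump1997, Prop. 4.2.3] -/
theorem boxFixed_le_of_stable (hLS : ∀ i ∈ S, L i = ⊥) (hLK : ∀ i, i ∉ S → L i = K i)
    (hfin : ∀ i, i ∉ S → ∀ a : G i, (orbit (L i) (a : G i ⧸ L i)).Finite)
    (π : Representation k (Πʳ i, [G i, K i]) V) [π.IsIrreducible]
    (hc : ∀ i, i ∉ S → ∀ a : G i, ∀ w ∈ Representation.fixedPoints (π.comp (mulSingleHom K i)) (L i),
      heckeOperator (π.comp (mulSingleHom K i)) (L i) a w = c i a • w)
    (Z : Submodule k V) (hZC : Z ≤ π.fixedPoints (boxSubgroup (K := K) L)) (hZ0 : Z ≠ ⊥)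
    (hZst : ∀ i ∈ S, ∀ (a : G i), ∀ z ∈ Z, π (RestrictedProduct.mulSingle K i a) z ∈ Z) :
    π.fixedPoints (boxSubgroup (K := K) L) ≤ Z := by
  intro x hx
  have hstab : ∀ γ : Πʳ i, [G i, K i], ∀ z ∈ Z, heckeOperator π (boxSubgroup (K := K) L) γ z ∈ Z := fun γ z hz => by
    obtain ⟨g₀, d, -, hg₀, hd⟩ := exists_heckeOperator_boxSubgroup_eq_smul (k := k) L S c hLS hLK hfin γ
    rw [hd V π hc z (hZC hz)]
    exact Z.smul_mem d (apply_mem_of_forall_mulSingle π S g₀ hg₀ Z hZst z hz)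
  refine mem_of_mem_span_translates_of_mem_fixedPoints π (boxSubgroup (K := K) L)
    (finite_orbit_boxSubgroup_of_eq L S hLS hLK hfin) hZC hstab ?_ hx
  rw [span_iUnion_image_eq_top π hZ0]
  trivial

/-- **(R4) The lift.**  `σ`, `ω` irreducible with the SAME local scalars `c i a` off `S`; `ψ : V → W` linear, mapping `σ^C` into
`ω^C`, non-zero there, and commuting on `σ^C` with the places of `S` (`ψ (σ (ι_i a) v) = ω (ι_i a) (ψ v)`).  Then `σ ≅ ω` by an
isomorphism agreeing with `ψ` on `σ^C`.  (Every `[CγC]` acts on both sides by `d • (g₀-translation)` with the same `d`, `g₀`, so `ψ`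
is Hecke-equivariant on `σ^C`; ★ `exists_equiv_of_heckeEquivariant`.)  The uniqueness half of Flath's theorem without restricted
tensor products and without Gelfand pairs. [cite: FlathCorvallis1979, Thm. 3] -/
theorem exists_equiv_of_boxFixed_equivariant {W : Type w} [AddCommGroup W] [Module k W]
    (hLS : ∀ i ∈ S, L i = ⊥) (hLK : ∀ i, i ∉ S → L i = K i)
    (hfin : ∀ i, i ∉ S → ∀ a : G i, (orbit (L i) (a : G i ⧸ L i)).Finite)
    (σ : Representation k (Πʳ i, [G i, K i]) V) (ω : Representation k (Πʳ i, [G i, K i]) W)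
    [σ.IsIrreducible] [ω.IsIrreducible]
    (hcσ : ∀ i, i ∉ S → ∀ a : G i, ∀ v ∈ Representation.fixedPoints (σ.comp (mulSingleHom K i)) (L i),
      heckeOperator (σ.comp (mulSingleHom K i)) (L i) a v = c i a • v)
    (hcω : ∀ i, i ∉ S → ∀ a : G i, ∀ w ∈ Representation.fixedPoints (ω.comp (mulSingleHom K i)) (L i),
      heckeOperator (ω.comp (mulSingleHom K i)) (L i) a w = c i a • w)
    (ψ : V →ₗ[k] W) (hψC : ∀ v ∈ σ.fixedPoints (boxSubgroup (K := K) L), ψ v ∈ ω.fixedPoints (boxSubgroup (K := K) L))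
    (hψeq : ∀ i ∈ S, ∀ (a : G i), ∀ v ∈ σ.fixedPoints (boxSubgroup (K := K) L),
      ψ (σ (RestrictedProduct.mulSingle K i a) v) = ω (RestrictedProduct.mulSingle K i a) (ψ v))
    (hψ0 : ∃ v ∈ σ.fixedPoints (boxSubgroup (K := K) L), ψ v ≠ 0) :
    ∃ e : σ.Equiv ω, ∀ v ∈ σ.fixedPoints (boxSubgroup (K := K) L), e v = ψ v := by
  -- `ψ` intertwines the `S`-parts `g₀` on `σ^C` (graph argument in `σ ⊕ ω`)
  have hψg : ∀ (g₀ : Πʳ i, [G i, K i]), (∀ i, i ∉ S → g₀ i = 1) →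
      ∀ v ∈ σ.fixedPoints (boxSubgroup (K := K) L), ψ (σ g₀ v) = ω g₀ (ψ v) := by
    intro g₀ hg₀ v hv
    let Zg : Submodule k (V × W) :=
      (σ.fixedPoints (boxSubgroup (K := K) L)).map ((LinearMap.id : V →ₗ[k] V).prod ψ)
    have hZg : ∀ i ∈ S, ∀ (a : G i), ∀ z ∈ Zg, (σ.prod ω) (RestrictedProduct.mulSingle K i a) z ∈ Zg := by
      rintro i hi a _ ⟨x, hx, rfl⟩
      refine ⟨σ (RestrictedProduct.mulSingle K i a) x,
        apply_mem_fixedPoints_boxSubgroup_of_support L S hLS σ (fun i' hi' => ?_) hx, ?_⟩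
      · exact RestrictedProduct.mulSingle_eq_of_ne' K a (fun h => hi' (h ▸ hi))
      · refine Prod.ext rfl ?_
        exact hψeq i hi a x hx
    have hmem := apply_mem_of_forall_mulSingle (σ.prod ω) S g₀ hg₀ Zg hZg (v, ψ v) ⟨v, hv, rfl⟩
    obtain ⟨x, -, hx⟩ := hmem
    have h1 : x = σ g₀ v := congrArg Prod.fst hx
    have h2 : ψ x = ω g₀ (ψ v) := congrArg Prod.snd hx
    rw [← h1, h2]
  refine exists_equiv_of_heckeEquivariant σ ω (boxSubgroup (K := K) L) (finite_orbit_boxSubgroup_of_eq L S hLS hLK hfin)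
    ψ hψC (fun γ v hv => ?_) hψ0
  obtain ⟨g₀, d, -, hg₀, hd⟩ := exists_heckeOperator_boxSubgroup_eq_smul (k := k) L S c hLS hLK hfin γ
  rw [hd V σ hcσ v hv, hd W ω hcω (ψ v) (hψC v hv), map_smul, hψg g₀ hg₀ v hv]

end Literature.NumberTheory.Automorphic

end
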